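import Summits.HubbardSuperconductivity.HubbardSuperconductivity.Theorems.KacWindowPenaltySandwich
import Summits.HubbardSuperconductivity.HubbardSuperconductivity.Theorems.TwTipContinuation.Negative.TipNormalForm
import Literature.MathematicalPhysics.QuantumLattice.PairFieldMomentum

/-!
# Route `KacWindowPenalty`: `TargetImpliesSummit` (stmt-HubbardSuperconductivity-1091),
# `TargetOfCruxes` (stmt-HubbardSuperconductivity-14282) and `Assembly` (stmt-HubbardSuperconductivity-1092)

Notation (even `L`, sector `K_L = szSector N_L 0`, `N_L = 2⌊(1−δ)L²/2⌋`, `H_L = hubbardTorus 2 L 1 U`):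
`Δ_d(m) = Σ_x e^{−2πi m·x/L} localPair_d x = pairFieldAt dWaveFormFactor L m` (the route's `let D`),
window `|q_m|² = momentumNormSq L m ≤ ε²`, Kac-window penalty
`W = Σ_{|q_m| ≤ ε} L⁻² Δ_d(m)ᴴΔ_d(m)` (the route's `let W`), window tail
`T_ε(ψ) = Σ_{m ≠ 0, |q_m| ≤ ε} ‖Δ_d(m)ψ‖²/L²`.

* `everyGS_floor_of_windowGap` — the finite-`L` core of `TargetImpliesSummit`: if
  `minEnergyOn (H_L + λW) K_L − minEnergyOn H_L K_L ≥ λ(σ + a)L²` (gap) and `T_ε(ψ) ≤ σL²` (tail) at a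
  normalised sector ground state `ψ` of `H_L`, then `a·L⁴ ≤ Re⟨ψ, Δ_dᴴΔ_d ψ⟩`. Proof: the landed
  `Sandwich` (`kacWindowPenalty_sandwich_proof`, stmt-1090) gives `λ Re⟨ψ, Wψ⟩ ≥ gap ≥ λ(σ+a)L²`;
  `Re⟨ψ, Wψ⟩ = Σ_{|q_m| ≤ ε} ‖Δ_d(m)ψ‖²/L²` (`re_expect_window`) splits at `m = 0` into
  `‖Δ_d(0)ψ‖²/L² + T_ε(ψ)` (`windowSum_split_zero`) and `Δ_d(0) = pairField` (`pairFieldAt_zero`).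
* `targetImpliesSummit_proof : TargetImpliesSummit` — the floor at every even `L ≥ L₀` and the tree's
  even-side `liminf` bookkeeping `summitMatrix_of_everyGSOrder`
  (`Theorems/TwTipContinuation/Negative/TipNormalForm.lean`).
* `targetOfCruxes_proof : TargetOfCruxes` — `WindowGap → WindowInfraredBound → Target`, the eight
  lines of the route's certified deciding theorem (σ := Cε).
* `kacWindowPenalty_assembly_proof : Assembly` — their composition.

Sources: D. J. Scalapino, Phys. Rep. 250 (1995) 329, §2 (pair-field LRO); Wang et al.,
arXiv:2310.05844, §II (observables certified from energy bounds); H. Tasaki, *Physics and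
Mathematics of Quantum Many-Body Systems* (2020) §2.1. Finite sums and linear arithmetic; no
definition is introduced.
-/

set_option linter.dupNamespace false

noncomputable section

namespace Summit.HubbardSuperconductivity.HubbardSuperconductivity.Theorems.KacWindowPenalty

open Matrix Finset Literature.MathematicalPhysics.QuantumLattice Literature.Probability.LatticeModels
open Summit.HubbardSuperconductivity.HubbardSuperconductivity.Theses.KacWindowPenalty
open Summit.HubbardSuperconductivity.TwTipContinuation.Negative (summitMatrix_of_everyGSOrder)
open scoped Classical ComplexOrder

section FiniteL

variable (L : ℕ) [NeZero L]

/-- **The window penalty in a state.** For the Kac-window penalty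
`W = Σ_{|q_m| ≤ ε} L⁻² Δ_d(m)ᴴΔ_d(m)`: `Re⟨ψ, Wψ⟩ = Σ_{|q_m| ≤ ε} ‖Δ_d(m)ψ‖²/L²` (window sum of the pair
structure factor). [folklore] -/
theorem re_expect_window (ε : ℝ) (ψ : Fock (Orb (FermionTorus 2 L))) :
    (star ψ ⬝ᵥ (∑ m : TorusSite 2 L, if momentumNormSq L m ≤ ε ^ 2 then
        ((L : ℂ) ^ 2)⁻¹ • ((pairFieldAt dWaveFormFactor L m)ᴴ * pairFieldAt dWaveFormFactor L m)
        else 0) *ᵥ ψ).re =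
      ∑ m : TorusSite 2 L, if momentumNormSq L m ≤ ε ^ 2 then
        pairStructureFactor dWaveFormFactor L ψ m else 0 := by
  rw [sum_mulVec, dotProduct_sum, Complex.re_sum]
  refine Finset.sum_congr rfl fun m _ => ?_
  split_ifs with hm
  · rw [smul_mulVec, dotProduct_smul, smul_eq_mul, ← star_mulVec_dotProduct_mulVec,
      pairStructureFactor_apply,
      show ((L : ℂ) ^ 2)⁻¹ = ((((L : ℝ) ^ 2)⁻¹ : ℝ) : ℂ) by push_cast; rfl, Complex.re_ofReal_mul,
      div_eq_inv_mul]
  · rw [zero_mulVec, dotProduct_zero, Complex.zero_re]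

/-- **Splitting the window sum at zero momentum**: `Σ_{|q_m| ≤ ε} S_ψ(m) = S_ψ(0) + T_ε(ψ)`
(`q_0 = 0` lies in every window). [folklore] -/
theorem windowSum_split_zero (ε : ℝ) (ψ : Fock (Orb (FermionTorus 2 L))) :
    (∑ m : TorusSite 2 L, if momentumNormSq L m ≤ ε ^ 2 then
        pairStructureFactor dWaveFormFactor L ψ m else 0) =
      pairStructureFactor dWaveFormFactor L ψ 0 +
        ∑ m : TorusSite 2 L, if m ≠ 0 ∧ momentumNormSq L m ≤ ε ^ 2 then
          pairStructureFactor dWaveFormFactor L ψ m else 0 := by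
  have h0 : momentumNormSq L (0 : TorusSite 2 L) ≤ ε ^ 2 := by
    rw [(momentumNormSq_eq_zero_iff (0 : TorusSite 2 L)).2 rfl]; exact sq_nonneg ε
  have key : ∀ m : TorusSite 2 L,
      (if momentumNormSq L m ≤ ε ^ 2 then pairStructureFactor dWaveFormFactor L ψ m else 0) =
        (if m = 0 then pairStructureFactor dWaveFormFactor L ψ 0 else 0) +
          (if m ≠ 0 ∧ momentumNormSq L m ≤ ε ^ 2 then
            pairStructureFactor dWaveFormFactor L ψ m else 0) := by
    intro m
    by_cases hm : m = 0
    · subst hm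
      rw [if_pos h0, if_pos rfl, if_neg (fun h => h.1 rfl), add_zero]
    · rw [if_neg hm, zero_add]
      by_cases hc : momentumNormSq L m ≤ ε ^ 2
      · rw [if_pos hc, if_pos ⟨hm, hc⟩]
      · rw [if_neg hc, if_neg (fun h => hc h.2)]
  rw [Finset.sum_congr rfl fun m _ => key m, Finset.sum_add_distrib, Finset.sum_ite_eq']
  simp

/-- **Every-ground-state floor from the window gap and the tail** (finite `L`, the core of
`TargetImpliesSummit`): if `λ(σ + a)L² ≤ minEnergyOn (H_L + λW) K − minEnergyOn H_L K` and the
normalised sector ground state `ψ` of `H_L` has window tail `T_ε(ψ) ≤ σL²`, then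
`a·L⁴ ≤ Re⟨ψ, Δ_dᴴΔ_d ψ⟩`: Sandwich (`λRe⟨ψ,Wψ⟩ ≥ gap`), the window sum split at `m = 0`, and
`Δ_d(0) = pairField`. Wang et al., arXiv:2310.05844, §II; Scalapino (1995) §2. [folklore] -/
theorem everyGS_floor_of_windowGap (U : ℝ) {ε lam σ a : ℝ} (hlam : 0 < lam) (N : ℕ)
    {ψ : Fock (Orb (FermionTorus 2 L))} (hψ1 : star ψ ⬝ᵥ ψ = 1)
    (hψ : IsGroundStateInSector (hubbardTorus 2 L 1 U) N 0 ψ)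
    (hgap : lam * (σ + a) * (L : ℝ) ^ 2 ≤
      (hubbardTorus 2 L 1 U + (lam : ℂ) • ∑ m : TorusSite 2 L, if momentumNormSq L m ≤ ε ^ 2 then
        ((L : ℂ) ^ 2)⁻¹ • ((pairFieldAt dWaveFormFactor L m)ᴴ * pairFieldAt dWaveFormFactor L m)
        else 0).minEnergyOn (szSector N 0) - (hubbardTorus 2 L 1 U).minEnergyOn (szSector N 0))
    (htail : (∑ m : TorusSite 2 L, if m ≠ 0 ∧ momentumNormSq L m ≤ ε ^ 2 then
        pairStructureFactor dWaveFormFactor L ψ m else 0) ≤ σ * (L : ℝ) ^ 2) :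
    a * (L : ℝ) ^ 4 ≤
      (expect ((pairField dWaveFormFactor L)ᴴ * pairField dWaveFormFactor L) ψ).re := by
  obtain ⟨hmem, -, heig⟩ := hψ
  have hL2 : (0 : ℝ) < (L : ℝ) ^ 2 := by
    have : (0 : ℝ) < L := by exact_mod_cast Nat.pos_of_ne_zero (NeZero.ne L)
    positivity
  -- Sandwich: gap ≤ λ Re⟨ψ, Wψ⟩
  have hS := kacWindowPenalty_sandwich_proof _ (hubbardTorus 2 L 1 U)
    (∑ m : TorusSite 2 L, if momentumNormSq L m ≤ ε ^ 2 then
        ((L : ℂ) ^ 2)⁻¹ • ((pairFieldAt dWaveFormFactor L m)ᴴ * pairFieldAt dWaveFormFactor L m)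
        else 0) (szSector N 0) ψ lam hlam hmem hψ1 heig
  rw [re_expect_window, windowSum_split_zero, pairStructureFactor_zero] at hS
  -- divide by λ
  have h1 : (σ + a) * (L : ℝ) ^ 2 ≤
      (expect ((pairField dWaveFormFactor L)ᴴ * pairField dWaveFormFactor L) ψ).re / (L : ℝ) ^ 2 +
        ∑ m : TorusSite 2 L, if m ≠ 0 ∧ momentumNormSq L m ≤ ε ^ 2 then
          pairStructureFactor dWaveFormFactor L ψ m else 0 := by
    refine le_of_mul_le_mul_left ?_ hlam
    rw [← mul_assoc]
    exact hgap.trans hS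
  have h2 : a * (L : ℝ) ^ 2 ≤
      (expect ((pairField dWaveFormFactor L)ᴴ * pairField dWaveFormFactor L) ψ).re / (L : ℝ) ^ 2 := by
    nlinarith
  rw [le_div_iff₀ hL2] at h2
  calc a * (L : ℝ) ^ 4 = a * (L : ℝ) ^ 2 * (L : ℝ) ^ 2 := by ring
    _ ≤ _ := h2

end FiniteL

/-- **`TargetImpliesSummit` holds** (route `KacWindowPenalty`, support item
`stmt-HubbardSuperconductivity-1091`): the target `X` (window gap + tail bound at some `(U, δ)`, all
large even `L`) gives `a·L⁴ ≤ Re⟨ψ, Δ_dᴴΔ_d ψ⟩` for every normalised sector ground state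
(`everyGS_floor_of_windowGap`; the route's `let D` is `pairFieldAt dWaveFormFactor L` by `rfl`), and
the even-side `liminf` bookkeeping `summitMatrix_of_everyGSOrder` turns this into the summit at the
same `(U, δ)`. Scalapino, Phys. Rep. 250 (1995) 329, §2. [cite: Scalapino1995] -/
theorem targetImpliesSummit_proof : TargetImpliesSummit := by
  unfold TargetImpliesSummit _root_.HubbardSuperconductivity
    Literature.Hubbard.DWaveSuperconductivityHubbard
  rintro ⟨U, hU, δ, hδ, ε, lam, σ, a, hε, hlam, hσ, ha, L₀, hX⟩
  refine ⟨U, hU, δ, hδ, summitMatrix_of_everyGSOrder ⟨a, ha, L₀, ?_⟩⟩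
  intro L inst hL hE ψ hψ1 hψ
  obtain ⟨hgap, htail⟩ := hX L hL hE
  exact everyGS_floor_of_windowGap L U hlam _ hψ1 hψ hgap (htail ψ hψ1 hψ)

/-- **`TargetOfCruxes` holds** (route `KacWindowPenalty`, support item
`stmt-HubbardSuperconductivity-14282`): `WindowGap → WindowInfraredBound → Target` — take `(U, δ)` from
`WindowGap`, `(C, ε₀, L₁)` from `WindowInfraredBound` at `(U, δ)`, `(ε, λ, a, L₀)` from `WindowGap` at
`(C, ε₀)`, and put `σ := Cε`, threshold `max L₀ L₁` (the route's certified deciding term, minus its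
first line). [folklore] -/
theorem targetOfCruxes_proof : TargetOfCruxes := by
  intro hGap hIR
  obtain ⟨U, hU, δ, hδ, hG⟩ := hGap
  obtain ⟨C, ε₀, hC, hε₀, L₁, hI⟩ := hIR U hU δ hδ
  obtain ⟨ε, hε, lam, a, hlam, ha, L₀, hG⟩ := hG C hC ε₀ hε₀
  refine ⟨U, hU, δ, hδ, ε, lam, C * ε, a, hε.1, hlam, mul_nonneg hC hε.1.le, ha, max L₀ L₁, ?_⟩
  intro L _ hL hEven
  exact ⟨hG L (le_of_max_le_left hL) hEven,
    fun ψ hψ hgs => hI ε hε L (le_of_max_le_right hL) hEven ψ hψ hgs⟩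

/-- **Route KacWindowPenalty's `Assembly` holds** (item `stmt-HubbardSuperconductivity-1092`):
`WindowGap → WindowInfraredBound → HubbardSuperconductivity`, as
`targetImpliesSummit_proof ∘ targetOfCruxes_proof`. Scalapino (1995) §2. [folklore] -/
theorem kacWindowPenalty_assembly_proof : Assembly := fun hGap hIR =>
  targetImpliesSummit_proof (targetOfCruxes_proof hGap hIR)

end Summit.HubbardSuperconductivity.HubbardSuperconductivity.Theorems.KacWindowPenalty
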